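import Literature.NumberTheory.EllipticCurves.Hsieh2014.AnticyclotomicMuInvariantAnyLevel

/-!
# Kernel-shortcut audit of `Hsieh2014.thmB_exists_isHsiehLFunction_coeff_norm_eq_one_unrPeriod_anyLevel`
# (PUB item stmt-BirchSwinnertonDyer-20711; stub `stub_thmB` of crux 22539, skeleton v16)

Seat bsd-wall-utd-b-w1 g4. Nothing here is a proof of the fact; these are the small kernel-checked lemmas
behind the memo `B3-STUBTHMB-KERNEL-AUDIT-utd-b-w1-g4.md`: the frame `IsHsiehLFunction` reads the central
`L`-values FAITHFULLY (no admissible choice of the ∃-parameters decouples the prescribed values of `Q` from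
`rankinSelbergValueHecke f χ 1`), the `L`-value is a `dite` over the unique-continuation predicate (opaque to the
kernel), and the `μ = 0` clause forces `Q ≠ 0`.
-/

noncomputable section

open scoped MatrixGroups ModularForm Topology NumberField
open CongruenceSubgroup NumberField IsDedekindDomain Field
open Literature.NumberTheory.GaloisRepresentations
open Literature.NumberTheory.EllipticCurves.ModularForms
open Literature.NumberTheory.Automorphic
open Literature.NumberTheory.EllipticCurves

namespace ThmBKernelAudit

universe u

variable {K : Type u} [Field K] [NumberField K] {N : ℕ}

/-- The `χ`-independent prefactor of Hsieh's display. -/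
def prefactor (p : ℕ) (n : ℕ) (A : ℝ) (ΩK C : ℂ) : ℂ :=
  Complex.Gamma n * Complex.Gamma (n + 1) * (if p ∣ N then (p : ℂ) ^ n else 1) * C /
    ((A : ℂ) ^ (2 * n) * (4 : ℂ) ^ (2 * n) * (Real.pi : ℂ) ^ (2 * n + 1) * ΩK ^ (4 * n))

/-- The `χ`-dependent arithmetic part: `(Euler factor at 𝔭)² · L(f/K, χ, 1)`. -/
def arithPart (p : ℕ) (f : CuspForm (Gamma0 N) 2) (𝔭 : HeightOneSpectrum (𝓞 K)) (χ : HeckeCharacter K) : ℂ :=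
  (1 - cuspCoeff f p * ((p : ℂ))⁻¹ * heckeValueExtZero χ 𝔭 +
      (if p ∣ N then 0 else ((p : ℂ))⁻¹) * heckeValueExtZero χ 𝔭 ^ 2) ^ 2 *
    rankinSelbergValueHecke f χ 1

/-- (C1) Hsieh's display = prefactor × arithmetic part. -/
theorem hsiehInterpolationValue_eq_prefactor_mul (p : ℕ) (f : CuspForm (Gamma0 N) 2)
    (𝔭 : HeightOneSpectrum (𝓞 K)) (χ : HeckeCharacter K) (n : ℕ) (A : ℝ) (ΩK C : ℂ) :
    hsiehInterpolationValue p f 𝔭 χ n A ΩK C = prefactor (N := N) p n A ΩK C * arithPart p f 𝔭 χ := by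
  unfold hsiehInterpolationValue prefactor arithPart
  simp only
  split_ifs <;> ring

/-- (C1′) The prefactor is nonzero for every ADMISSIBLE choice of the ∃-parameters of the fact
(`0 < A`, `Ω_K ≠ 0`, `C ≠ 0` — forced by `‖ι⁻¹ C‖ = 1`) at every interpolation weight `n ≥ 1`. -/
theorem prefactor_ne_zero {p : ℕ} (hp : p ≠ 0) {n : ℕ} (hn : 0 < n) {A : ℝ} (hA : 0 < A) {ΩK C : ℂ}
    (hΩK : ΩK ≠ 0) (hC : C ≠ 0) : prefactor (N := N) p n A ΩK C ≠ 0 := by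
  unfold prefactor
  have hΓ1 : Complex.Gamma (n : ℂ) ≠ 0 := by
    apply Complex.Gamma_ne_zero
    intro m
    have : (0 : ℝ) < (n : ℂ).re := by simp; exact_mod_cast hn
    intro h
    have h2 := congrArg Complex.re h
    simp at h2
    have : (n : ℝ) = -(m : ℝ) := by exact_mod_cast h2
    have hm : (0 : ℝ) ≤ m := by positivity
    have hn' : (0 : ℝ) < n := by exact_mod_cast hn
    linarith
  have hΓ2 : Complex.Gamma ((n : ℂ) + 1) ≠ 0 := by
    apply Complex.Gamma_ne_zero
    intro m h
    have h2 := congrArg Complex.re h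
    simp at h2
    have hm : (0 : ℝ) ≤ m := by positivity
    have hn' : (0 : ℝ) ≤ n := by positivity
    linarith
  have hρ : (if p ∣ N then (p : ℂ) ^ n else 1) ≠ 0 := by
    split_ifs
    · exact pow_ne_zero _ (by exact_mod_cast hp)
    · exact one_ne_zero
  have hA' : (A : ℂ) ^ (2 * n) ≠ 0 := pow_ne_zero _ (by exact_mod_cast hA.ne')
  have h4 : (4 : ℂ) ^ (2 * n) ≠ 0 := pow_ne_zero _ (by norm_num)
  have hπ : (Real.pi : ℂ) ^ (2 * n + 1) ≠ 0 := pow_ne_zero _ (by exact_mod_cast Real.pi_ne_zero)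
  have hΩ : ΩK ^ (4 * n) ≠ 0 := pow_ne_zero _ hΩK
  exact div_ne_zero (mul_ne_zero (mul_ne_zero (mul_ne_zero hΓ1 hΓ2) hρ) hC)
    (mul_ne_zero (mul_ne_zero (mul_ne_zero hA' h4) hπ) hΩ)

/-- (C1″) Hence, for admissible parameters, Hsieh's display vanishes iff the arithmetic part
`(Euler factor)² · L(f/K, χ, 1)` vanishes: the frame cannot be decoupled from the `L`-values. -/
theorem hsiehInterpolationValue_eq_zero_iff {p : ℕ} (hp : p ≠ 0) (f : CuspForm (Gamma0 N) 2)
    (𝔭 : HeightOneSpectrum (𝓞 K)) (χ : HeckeCharacter K) {n : ℕ} (hn : 0 < n) {A : ℝ} (hA : 0 < A)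
    {ΩK C : ℂ} (hΩK : ΩK ≠ 0) (hC : C ≠ 0) :
    hsiehInterpolationValue p f 𝔭 χ n A ΩK C = 0 ↔ arithPart p f 𝔭 χ = 0 := by
  rw [hsiehInterpolationValue_eq_prefactor_mul, mul_eq_zero, or_iff_right (prefactor_ne_zero hp hn hA hΩK hC)]

variable {p : ℕ} [Fact p.Prime]

/-- (C2) `‖ι⁻¹ C‖_p = 1` forces `C ≠ 0`. -/
theorem ne_zero_of_norm_symm_eq_one (ι : PadicAlgCl p ≃+* ℂ) {C : ℂ}
    (hC : ‖((ι.symm C : PadicAlgCl p) : ℂ_[p])‖ = 1) : C ≠ 0 := by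
  rintro rfl
  simp at hC

/-- (C2′) A unit of `R₀` is nonzero in `ℂ_p`, so `Ω_p^{4n} ≠ 0`. -/
theorem unrPeriod_pow_ne_zero (Ωp : (unrIntegers p)ˣ) (m : ℕ) :
    (((Ωp : unrIntegers p) : ℂ_[p])) ^ m ≠ 0 := by
  apply pow_ne_zero
  have h := (unrIntegers.isUnit_iff_norm_eq_one (Ωp : unrIntegers p)).mp Ωp.isUnit
  intro h0
  rw [h0, norm_zero] at h
  exact zero_ne_one h

/-- (C2″) The value the frame PRESCRIBES at the character `χ` (weight `n ≥ 1`) is zero iff the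
arithmetic part is: `ι⁻¹(display) · Ω_p^{4n} = 0 ↔ (Euler factor)² · L(f/K, χ, 1) = 0`. -/
theorem prescribedValue_eq_zero_iff (ι : PadicAlgCl p ≃+* ℂ) (f : CuspForm (Gamma0 N) 2)
    (𝔭 : HeightOneSpectrum (𝓞 K)) (χ : HeckeCharacter K) {n : ℕ} (hn : 0 < n) {A : ℝ} (hA : 0 < A)
    {ΩK C : ℂ} (hΩK : ΩK ≠ 0) (hC : ‖((ι.symm C : PadicAlgCl p) : ℂ_[p])‖ = 1) (Ωp : (unrIntegers p)ˣ) :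
    ((ι.symm (hsiehInterpolationValue p f 𝔭 χ n A ΩK C) : PadicAlgCl p) : ℂ_[p]) *
        (((Ωp : unrIntegers p) : ℂ_[p])) ^ (4 * n) = 0 ↔ arithPart p f 𝔭 χ = 0 := by
  rw [mul_eq_zero, or_iff_left (unrPeriod_pow_ne_zero Ωp _)]
  have hp : p ≠ 0 := (Fact.out : p.Prime).ne_zero
  rw [← hsiehInterpolationValue_eq_zero_iff hp f 𝔭 χ hn hA hΩK (ne_zero_of_norm_symm_eq_one ι hC)]
  constructor
  · intro h
    have h1 : (ι.symm (hsiehInterpolationValue p f 𝔭 χ n A ΩK C) : PadicAlgCl p) = 0 := by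
      apply UniformSpace.Completion.coe_injective (PadicAlgCl p)
      simpa using h
    simpa using congrArg ι h1
  · intro h
    rw [h]; simp

open scoped Classical in
/-- (C3) The `L`-value is, by definition, a `dite` over the unique-continuation predicate — no lemma
of the tree evaluates it (the kernel can neither compute it nor decide `= 0`). -/
theorem rankinSelbergValueHecke_unfold (f : CuspForm (Gamma0 N) 2) (χ : HeckeCharacter K) (s₀ : ℂ) :
    rankinSelbergValueHecke f χ s₀ =
      if h : ∃! L₀ : ℂ, IsRankinSelbergValueHecke f χ s₀ L₀ then h.choose else 0 := rfl

/-- (C4) The `μ = 0` clause of the fact excludes the zero series: under the conclusion `Q ≠ 0`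
(tree lemma `Hsieh2014.ne_zero_of_coeff_norm_eq_one`). -/
theorem Q_ne_zero_of_clause {Q : PowerSeries (PadicComplexInt p)}
    (h : ∃ n : ℕ, ‖((PowerSeries.coeff n Q : PadicComplexInt p) : ℂ_[p])‖ = 1) : Q ≠ 0 :=
  Hsieh2014.ne_zero_of_coeff_norm_eq_one h

end ThmBKernelAudit

end
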